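import Literature.NumberTheory.GaloisRepresentations.ConjugationDescent
import HarnessLib

/-!
# The `Gal`-action and the relative norm on `H¹` of nested open subgroups: `res ∘ res`,
# `res ∘ conj = conj ∘ res`, `res ∘ cor = Σ conj`, powers of `conj`, torsion
# (cell `b2b-bsdres`, team n1011, seat p11 GEN 7, OWNERS row T-DER = skel/T-DER.md; file F2)

HONEST FRAMING (cell `b2b-bsdres`, run/shared/lean/b2b/bsd-rank1-residual/, verbatim in every
file): the goal of the cell is to DELETE the COMBINATION-SHAPED residual classes of the
Birch–Swinnerton-Dyer formula for ALL analytic-rank `≤ 1` elliptic curves over `ℚ` — "full BSD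
formula for every rank `≤ 1` curve in class `C`" assembled STRICTLY from published theorems — so
that the rank-`≤ 1` remainder becomes exactly the CONSTRUCTION-SHAPED classes, which are TYPED
(missing-input `Prop`s), NOT attempted. This is not "finishing BSD". Team n1011 (N10 / N11, the
additive block X4 ∧ `p = 3`): research route on the CONSTRUCTION-SHAPED class X4; no claim beyond the
stated classes; nothing is booked. TOOL theorems of continuous group cohomology (no definition, no
named fact, no `sorry`); nothing specific to elliptic curves.

## Why (row T-DER: Euler systems → Kolyvagin systems, [Rubin00] §4.4 / [MR04] Thm. 3.2.4)

Kolyvagin's derivative is applied to the classes of an Euler system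
(`Literature.…GaloisRepresentations.EulerSystem`: `c r ∈ H¹(Gal(K̄/K(r)), T)`) after restriction
to a common level `H¹(Gal(K̄/K(r)), ·)`.  The Euler-system axiom is a CORESTRICTION identity
(`Cor c_{K(rq)} = P(Fr_q⁻¹ | T*; Fr_q⁻¹) c_{K(r)}`, tree `IsEulerSystem.cores_cons`, stated with the
relative corestriction `coresLe` of `ContinuousCorestriction`); the derivative construction consumes
it as the NORM RELATION `N_{Gal(K(rq)/K(r))} c_{K(rq)} = res (P(Fr_q⁻¹) c_{K(r)})` in
`H¹(Gal(K̄/K(rq)), ·)`, i.e. after applying `res ∘ cor = Σ_{g ∈ Gal(K(rq)/K(r))} g`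
([Rubin00] proof of Lemma 4.4.2; [NSW] I (1.5.7)).  The tree has this formula for an open normal
subgroup of the WHOLE group (`resSubgroup_cores_eq_sum`, file `ConjugationDescent`); this file
supplies the RELATIVE version for `coresLe` (nested subgroups `H ≤ H'` of `G`, `H` normal in `G`)
and the small calculus needed to move the `Gal`-action (`conjMap`) and the restrictions (`resLe`)
past each other, all in degree one via explicit cocycles.

## Contents (namespace `…GaloisImage.Derivative`; `X : TopRep R G` arbitrary)

* `resLe_resLe` — transitivity of restriction; `resLe_conjMap` — `res ∘ g = g ∘ res` for nested
  normal subgroups; `conjMap_eq_self_of_mem` — `g ∈ H` acts trivially on `H¹(H, X)` (re-export of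
  the tree lemma in the form used here).
* `resLe_coresLe_eq_sum` — **`res_{H} ∘ cor_{H'/H} = Σ_{x ∈ H'/H} (s x)·`** on `H¹(H, X)` for
  `H ≤ H'`, `H ⊴ G` open of finite index in `H'`, any representatives `s`.
* `conjMap_hom_pow_apply` — `(g·)^i = (g^i)·` as endomorphisms of `H¹(H, X)`;
  `commute_conjMap_hom` — the operators of two elements commuting modulo `H` commute.
* `smul_eq_zero_of_forall_smul_eq_zero` — if `a ∈ R` kills the module `X` it kills `H¹(H, X)`.

References: K. Rubin, *Euler Systems* (2000), §4.4 (proof of Lemma 4.4.2); J. Neukirch, A. Schmidt,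
K. Wingberg, *Cohomology of Number Fields* (2008), I §5 (1.5.6)–(1.5.7) (`res ∘ cor = N_{G/U}`);
J.-P. Serre, *Local Fields* (1979), VII §5–§7.
-/

noncomputable section

open CategoryTheory Function Finset
open Literature.NumberTheory.GaloisRepresentations
open Literature.NumberTheory.EllipticCurves (subgroupInclusion subgroupInclusion_apply_coe
  subgroupConj subgroupConj_apply_coe schreierElt schreierElt_coe schreierElt_coe_eq_subgroupConj
  coe_smul_quotient_eq)

universe u v

namespace Summit.BirchSwinnertonDyer.Rank1Residual.GaloisImage

namespace Derivative

variable {R : Type u} [CommRing R] [TopologicalSpace R]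
variable {G : Type v} [Group G] [TopologicalSpace G] [IsTopologicalGroup G]
variable (X : TopRep.{v} R G)

/-! ### Restriction: transitivity and compatibility with the `Gal`-action -/

/-- **Transitivity of restriction** `res_{H ≤ H'} ∘ res_{H' ≤ H''} = res_{H ≤ H''}` on `H¹`.
Ref: Serre, *Galois Cohomology* (1997), I §2.4. [folklore] -/
theorem resLe_resLe {H H' H'' : Subgroup G} (h : H ≤ H') (h' : H' ≤ H'')
    (y : continuousCohomology 1 (subgroupRep X H'')) :
    resLe X h 1 (resLe X h' 1 y) = resLe X (h.trans h') 1 y := by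
  obtain ⟨φ, rfl⟩ := oneCocycleClass_surjective _ y
  rw [resLe_oneCocycleClass, resLe_oneCocycleClass, resLe_oneCocycleClass]
  exact congrArg _ (Subtype.ext (ContinuousMap.ext fun _ => rfl))

/-- Restriction along `H ≤ H` is the identity on `H¹`. [folklore] -/
theorem resLe_refl_apply {H : Subgroup G} (y : continuousCohomology 1 (subgroupRep X H)) :
    resLe X (le_refl H) 1 y = y := by
  obtain ⟨φ, rfl⟩ := oneCocycleClass_surjective _ y
  rw [resLe_oneCocycleClass]
  exact congrArg _ (Subtype.ext (ContinuousMap.ext fun _ => rfl))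

/-- **`res ∘ (g·) = (g·) ∘ res`**: restriction between nested normal subgroups `H ≤ H'` of `G`
commutes with the action of `g ∈ G` on `H¹(H', X)` and `H¹(H, X)` (on cocycles both sides are
`x ↦ g • φ(g⁻¹ x g)`).  Ref: Serre, *Local Fields* (1979), VII §5. [folklore] -/
theorem resLe_conjMap {H H' : Subgroup G} [H.Normal] [H'.Normal] (h : H ≤ H') (g : G)
    (y : continuousCohomology 1 (subgroupRep X H')) :
    resLe X h 1 (conjMap X H' g 1 y) = conjMap X H g 1 (resLe X h 1 y) := by
  obtain ⟨φ, rfl⟩ := oneCocycleClass_surjective _ y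
  rw [conjMap_oneCocycleClass, resLe_oneCocycleClass, resLe_oneCocycleClass,
    conjMap_oneCocycleClass]
  exact congrArg _ (Subtype.ext (ContinuousMap.ext fun _ => rfl))

/-- Elements of `H` act trivially on `H¹(H, X)` (inner automorphisms; tree
`conjMap_eq_self_of_mem_one`, restated with the element in `G`). [folklore] -/
theorem conjMap_eq_self_of_mem {H : Subgroup G} [H.Normal] {g : G} (hg : g ∈ H)
    (y : continuousCohomology 1 (subgroupRep X H)) : conjMap X H g 1 y = y :=
  conjMap_eq_self_of_mem_one X H hg y

/-- Two elements with the same class modulo `H` act alike on `H¹(H, X)`. [folklore] -/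
theorem conjMap_eq_conjMap_of_inv_mul_mem {H : Subgroup G} [H.Normal] {g g' : G}
    (hg : g⁻¹ * g' ∈ H) (y : continuousCohomology 1 (subgroupRep X H)) :
    conjMap X H g' 1 y = conjMap X H g 1 y := by
  have e : g' = g * (g⁻¹ * g') := by group
  rw [e, ← conjMap_conjMap X H (g⁻¹ * g') g 1 y, conjMap_eq_self_of_mem X hg]

/-! ### The relative norm formula `res ∘ cor = Σ conj` -/

/-- **`res_H ∘ cor_{H'/H} = Σ_{x ∈ H'/H} (s x)·` on `H¹(H, X)`** for subgroups `H ≤ H'` of `G` with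
`H` normal in `G`, open and of finite index in `H'`, and any system `s` of representatives of
`H' ⧸ H`: on cocycles, the transfer of `φ` restricted back to `H` is
`n ↦ Σ_x s(x) • φ(s(x)⁻¹ n s(x))` (`n • x = x` for `n ∈ H`).  This is the relative form of the
tree's `resSubgroup_cores_eq_sum` (the case `H' = G`), for the relative corestriction `coresLe`
of `ContinuousCorestriction` through which the Euler-system axioms are stated.
Ref: Neukirch–Schmidt–Wingberg, *Cohomology of Number Fields* (2008), I §5 (1.5.6)–(1.5.7);
Rubin, *Euler Systems* (2000), proof of Lemma 4.4.2. [folklore] -/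
theorem resLe_coresLe_eq_sum {H H' : Subgroup G} [H.Normal] (h : H ≤ H') (hH : IsOpen (H : Set G))
    [Fintype (H' ⧸ H.subgroupOf H')] {s : H' ⧸ H.subgroupOf H' → H'}
    (hs : ∀ x, (s x : H' ⧸ H.subgroupOf H') = x) (y : continuousCohomology 1 (subgroupRep X H)) :
    resLe X h 1 (coresLe X h hH y) = ∑ x, conjMap X H ((s x : H') : G) 1 y := by
  obtain ⟨φ, rfl⟩ := oneCocycleClass_surjective _ y
  rw [coresLe_oneCocycleClass X h hH hs, resLe_oneCocycleClass]
  have hrhs : oneCocycleClass _ (∑ x : H' ⧸ H.subgroupOf H',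
        contOneCocycles.pullback (subgroupConj H ((s x : H') : G)) (conjRepHom X H ((s x : H') : G))
          φ) =
      ∑ x : H' ⧸ H.subgroupOf H', conjMap X H ((s x : H') : G) 1 (oneCocycleClass _ φ) := by
    rw [← oneCocycleClassₗ_apply, map_sum]
    exact Finset.sum_congr rfl fun x _ => by rw [oneCocycleClassₗ_apply, conjMap_oneCocycleClass]
  rw [← hrhs]
  refine congrArg _ (Subtype.ext (ContinuousMap.ext fun n => ?_))
  -- the element `n ∈ H` seen in `H.subgroupOf H'`
  have hn : (subgroupInclusion h n : H') ∈ H.subgroupOf H' := by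
    rw [Subgroup.mem_subgroupOf]
    exact n.2
  rw [contOneCocycles.pullback_apply, sum_apply_val']
  change transferFun (subgroupRep X H') (H.subgroupOf H') hs _ (subgroupInclusion h n) = _
  rw [transferFun_apply]
  refine Finset.sum_congr rfl fun x _ => ?_
  rw [conj_pullback_apply, contOneCocycles.pullback_apply,
    show subgroupInclusion h n = ((⟨subgroupInclusion h n, hn⟩ : H.subgroupOf H') : H') from rfl,
    coe_smul_quotient_eq (H.subgroupOf H') ⟨subgroupInclusion h n, hn⟩ x,
    schreierElt_coe_eq_subgroupConj]
  rfl

/-! ### The operators `(g·)` as endomorphisms: powers, commutation, torsion -/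

/-- **Powers of the action**: `((g·))^i = (g^i·)` on `H¹(H, X)` (as `R`-linear endomorphisms).
[folklore] -/
theorem conjMap_hom_pow_apply {H : Subgroup G} [H.Normal] (g : G) (i : ℕ)
    (y : continuousCohomology 1 (subgroupRep X H)) :
    ((conjMap X H g 1).hom.toLinearMap ^ i) y = conjMap X H (g ^ i) 1 y := by
  induction i generalizing y with
  | zero => rw [pow_zero, pow_zero, Module.End.one_apply, conjMap_one_one]
  | succ i ih =>
    rw [pow_succ, Module.End.mul_apply, ContinuousLinearMap.coe_coe]
    change ((conjMap X H g 1).hom.toLinearMap ^ i) (conjMap X H g 1 y) = _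
    rw [ih, conjMap_conjMap, pow_succ]

/-- The operators of two elements `a, b ∈ G` whose commutator lies in `H` commute on `H¹(H, X)`
(e.g. any two elements when `G ⧸ H` is abelian). [folklore] -/
theorem commute_conjMap_hom {H : Subgroup G} [H.Normal] {a b : G} (hab : a⁻¹ * b⁻¹ * a * b ∈ H) :
    Commute (conjMap X H a 1).hom.toLinearMap (conjMap X H b 1).hom.toLinearMap := by
  refine LinearMap.ext fun y => ?_
  change conjMap X H a 1 (conjMap X H b 1 y) = conjMap X H b 1 (conjMap X H a 1 y)
  rw [conjMap_conjMap, conjMap_conjMap]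
  refine conjMap_eq_conjMap_of_inv_mul_mem X ?_ y
  have e : (b * a)⁻¹ * (a * b) = a⁻¹ * b⁻¹ * a * b := by group
  rwa [e]

omit [IsTopologicalGroup G] in
/-- **Torsion transfers to cohomology**: if `a ∈ R` kills the module `X`, it kills `H¹(H, X)`
(a class is represented by a cocycle `φ`, and `a • φ = 0` pointwise). [folklore] -/
theorem smul_eq_zero_of_forall_smul_eq_zero [IsTopologicalGroup G] {H : Subgroup G} (a : R)
    (ha : ∀ v : X, a • v = 0) (y : continuousCohomology 1 (subgroupRep X H)) : a • y = 0 := by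
  obtain ⟨φ, rfl⟩ := oneCocycleClass_surjective _ y
  rw [← oneCocycleClass_smul, ← oneCocycleClass_zero]
  refine congrArg _ (Subtype.ext (ContinuousMap.ext fun x => ?_))
  change a • φ.1 x = 0
  exact ha _

end Derivative

end Summit.BirchSwinnertonDyer.Rank1Residual.GaloisImage

end
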